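import Mathlib
import Summits.Ventures.HodgeRepro.Tier4.Line1.RTFSetting
import Summits.Ventures.HodgeRepro.Tier4.Line1.IsotypicIdempotent

/-!
# Tier4/Line1/IsotypicSchur — SCHUR ORTHOGONALITY for one irreducible unitary `ρ` of a compact open `K` against `S.μ`,
and the IDEMPOTENT IDENTITY `conv eσ eσ = eσ` (plan-1's cut (S3σ) S14082; consumer p5's `HeckeBlockW.ofIdempotent` S14087)

Blind re-derivation cell `pub-hodge-repro`, Tier 4 (README §9–§10), seat t4-L1-p3 (prover, LINE L1, gen 3).  Target tree
path `lean/Summits/Ventures/HodgeRepro/Tier4/Line1/IsotypicSchur.lean`.  Imports `RTFSetting` and this seat's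
`IsotypicIdempotent` (`repExt`, `charExt`, `eσ`, `IsIrreducibleRep`, `continuous_repExt`, `eσ_of_not_mem`,
`measure_toReal_ne_zero`).  Paper proof: proofs/t4/L1/S3sigma-isotypic-idempotent-t4-L1-p3.md §2–§3.  0 printed inputs.

CONTENT.  Lemma A `setIntegral_K_mul_left` (translation on `K` by `k₀ ∈ K`: `integral_indicator` + the left invariance
`integral_mul_left_eq_self` of `S.μ`); the averaged matrix `schurMatrix j k` with entries `∫_K ρ(h)_{ij} ρ(h⁻¹)_{kl} dμ`
(scalar integrals against the SAME `S.μ` as `R_R_indK`); Lemma B `schurMatrix_comm` (it commutes with `ρ(K)`); Lemma C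
`eq_smul_one_of_comm` (SCHUR: a matrix commuting with an irreducible `ρ` is a scalar — `Module.End.exists_eigenvalue`,
the eigenspace is `ρ`-stable, irreducibility); Lemma D `trace_schurMatrix`; **Theorem E `schur_orthogonality`**
`∫_K ρ(h)_{ij} ρ(h⁻¹)_{kl} dμ(h) = (μ(K)/d) [i = l][k = j]`; Lemma F `charExt_conv` (`∫_K χ(h) χ(h⁻¹ g) dμ = (μ(K)/d) χ(g)`
for `g ∈ K`); **Theorem G `conv_eσ_eσ : S.conv eσ eσ = eσ`** with the volume constant explicit (`d · μ(K)⁻¹`).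
Irreducibility is a DISPLAYED hypothesis (`IsIrreducibleRep ρ`), never derived.  NOT claimed: anything about the
fixed space of `R(eσ)`, the Hecke block, (C1), (C2), the instance's corner forms, or `P_T4`.  Nothing here says anything
about the status of the Hodge conjecture for CM abelian varieties, which is NOT proved (HC_CM is NOT proved by anyone in
this repository).
-/

set_option autoImplicit false

noncomputable section

namespace Summit.Ventures.HodgeRepro.Tier4.Line1

open MeasureTheory Topology Set Matrix

namespace RTF.Setting

variable {G : Type} [Group G] [TopologicalSpace G] [IsTopologicalGroup G] [MeasurableSpace G] [BorelSpace G]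
  (S : Setting G) (K : Subgroup G) {d : ℕ} (ρ : K →* Matrix (Fin d) (Fin d) ℂ)

section Schur

variable (hKo : IsOpen (K : Set G)) (hKc : IsCompact (K : Set G)) (hρ : Continuous ρ)

include hKo in
/-- **Lemma A**: translation of a set integral over `K` by an element of `K` (left invariance of `S.μ`). -/
theorem setIntegral_K_mul_left (F : G → ℂ) {k₀ : G} (hk₀ : k₀ ∈ K) :
    ∫ h in (K : Set G), F (k₀ * h) ∂S.μ = ∫ h in (K : Set G), F h ∂S.μ := by
  haveI := S.haar
  have hm : MeasurableSet (K : Set G) := hKo.measurableSet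
  rw [← integral_indicator hm, ← integral_indicator hm]
  have : ((K : Set G).indicator fun h => F (k₀ * h)) = fun h => (K : Set G).indicator F (k₀ * h) := by
    funext h
    by_cases hh : h ∈ K
    · rw [Set.indicator_of_mem (show h ∈ (K : Set G) from hh),
        Set.indicator_of_mem (show k₀ * h ∈ (K : Set G) from K.mul_mem hk₀ hh)]
    · rw [Set.indicator_of_notMem (show h ∉ (K : Set G) from hh), Set.indicator_of_notMem]
      intro hc
      exact hh (by simpa using K.mul_mem (K.inv_mem hk₀) hc)
  rw [this]
  exact integral_mul_left_eq_self ((K : Set G).indicator F) k₀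

include hKo hKc hρ in
/-- the matrix-coefficient products are integrable on `K` (continuous, support in the compact `K`). -/
theorem integrableOn_coef_mul (i j k l : Fin d) :
    IntegrableOn (fun h => repExt K ρ h i j * repExt K ρ h⁻¹ k l) (K : Set G) S.μ := by
  haveI := S.haar
  have hc : Continuous fun h : G => repExt K ρ h i j * repExt K ρ h⁻¹ k l :=
    ((continuous_repExt K ρ hKo hρ).matrix_elem i j).mul
      (((continuous_repExt K ρ hKo hρ).comp continuous_inv).matrix_elem k l)
  have hs : HasCompactSupport fun h : G => repExt K ρ h i j * repExt K ρ h⁻¹ k l :=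
    HasCompactSupport.intro' hKc (K.isClosed_of_isOpen hKo) fun g hg => by
      simp [repExt_of_not_mem K ρ hg]
  exact (hc.integrable_of_hasCompactSupport hs).integrableOn

/-- the averaged matrix `B_{il} = ∫_K ρ(h)_{ij} ρ(h⁻¹)_{kl} dμ(h)` (entrywise scalar integrals against `S.μ`). -/
def schurMatrix (j k : Fin d) : Matrix (Fin d) (Fin d) ℂ :=
  Matrix.of fun i l => ∫ h in (K : Set G), repExt K ρ h i j * repExt K ρ h⁻¹ k l ∂S.μ

include hKo hKc hρ in
/-- **Lemma B**: the averaged matrix commutes with `ρ(k₀)` for every `k₀ ∈ K`. -/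
theorem schurMatrix_comm (j k : Fin d) {k₀ : G} (hk₀ : k₀ ∈ K) :
    repExt K ρ k₀ * schurMatrix S K ρ j k = schurMatrix S K ρ j k * repExt K ρ k₀ := by
  haveI := S.haar
  have hm : MeasurableSet (K : Set G) := hKo.measurableSet
  ext i l
  simp only [Matrix.mul_apply, schurMatrix, Matrix.of_apply]
  have hL : ∀ a, repExt K ρ k₀ i a * ∫ h in (K : Set G), repExt K ρ h a j * repExt K ρ h⁻¹ k l ∂S.μ
      = ∫ h in (K : Set G), repExt K ρ k₀ i a * (repExt K ρ h a j * repExt K ρ h⁻¹ k l) ∂S.μ :=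
    fun a => (integral_const_mul _ _).symm
  have hR : ∀ b, (∫ h in (K : Set G), repExt K ρ h i j * repExt K ρ h⁻¹ k b ∂S.μ) * repExt K ρ k₀ b l
      = ∫ h in (K : Set G), repExt K ρ h i j * repExt K ρ h⁻¹ k b * repExt K ρ k₀ b l ∂S.μ :=
    fun b => (integral_mul_const _ _).symm
  simp_rw [hL, hR]
  rw [← integral_finsetSum _ (fun a _ => (integrableOn_coef_mul S K ρ hKo hKc hρ a j k l).const_mul _),
    ← integral_finsetSum _ (fun b _ => (integrableOn_coef_mul S K ρ hKo hKc hρ i j k b).mul_const _)]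
  have hL2 : ∫ h in (K : Set G), ∑ a, repExt K ρ k₀ i a * (repExt K ρ h a j * repExt K ρ h⁻¹ k l) ∂S.μ
      = ∫ h in (K : Set G), repExt K ρ (k₀ * h) i j * repExt K ρ h⁻¹ k l ∂S.μ := by
    refine setIntegral_congr_fun hm fun h hh => ?_
    rw [repExt_mul K ρ hk₀ hh, Matrix.mul_apply, Finset.sum_mul]
    simp only [mul_assoc]
  have hR2 : ∫ h in (K : Set G), ∑ b, repExt K ρ h i j * repExt K ρ h⁻¹ k b * repExt K ρ k₀ b l ∂S.μ
      = ∫ h in (K : Set G), repExt K ρ h i j * repExt K ρ (h⁻¹ * k₀) k l ∂S.μ := by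
    refine setIntegral_congr_fun hm fun h hh => ?_
    rw [repExt_mul K ρ (K.inv_mem hh) hk₀, Matrix.mul_apply, Finset.mul_sum]
    simp only [mul_assoc]
  rw [hL2, hR2]
  calc ∫ h in (K : Set G), repExt K ρ (k₀ * h) i j * repExt K ρ h⁻¹ k l ∂S.μ
      = ∫ h in (K : Set G), (fun h => repExt K ρ h i j * repExt K ρ (h⁻¹ * k₀) k l) (k₀ * h) ∂S.μ := by
        refine setIntegral_congr_fun hm fun h _ => ?_
        simp only [_root_.mul_inv_rev, inv_mul_cancel_right]
    _ = ∫ h in (K : Set G), (fun h => repExt K ρ h i j * repExt K ρ (h⁻¹ * k₀) k l) h ∂S.μ :=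
        setIntegral_K_mul_left S K hKo (fun h => repExt K ρ h i j * repExt K ρ (h⁻¹ * k₀) k l) hk₀

omit [TopologicalSpace G] [IsTopologicalGroup G] [MeasurableSpace G] [BorelSpace G] in
/-- **Lemma C (Schur)**: a matrix commuting with every `ρ(k)` is a scalar (ℂ algebraically closed, `ρ` irreducible). -/
theorem eq_smul_one_of_comm (hirr : IsIrreducibleRep ρ) (B : Matrix (Fin d) (Fin d) ℂ)
    (hB : ∀ k : K, ρ k * B = B * ρ k) : ∃ c : ℂ, B = c • (1 : Matrix (Fin d) (Fin d) ℂ) := by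
  rcases Nat.eq_zero_or_pos d with hd | hd
  · subst hd
    exact ⟨0, Subsingleton.elim _ _⟩
  · haveI : NeZero d := ⟨hd.ne'⟩
    obtain ⟨c, hc⟩ := Module.End.exists_eigenvalue (Matrix.toLin' B)
    obtain ⟨v, hv⟩ := hc.exists_hasEigenvector
    have hv1 : B.mulVec v = c • v := by
      have := hv.apply_eq_smul
      rwa [Matrix.toLin'_apply] at this
    have hv0 : v ≠ 0 := (Module.End.hasEigenvector_iff.mp hv).2
    set U := Module.End.eigenspace (Matrix.toLin' B) c with hU
    have hstab : ∀ k : K, ∀ w ∈ U, (ρ k).mulVec w ∈ U := by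
      intro k w hw
      rw [hU, Module.End.mem_eigenspace_iff, Matrix.toLin'_apply] at hw ⊢
      rw [Matrix.mulVec_mulVec, ← hB k, ← Matrix.mulVec_mulVec, hw, Matrix.mulVec_smul]
    have hne : U ≠ ⊥ := by
      intro h0
      have hvU : v ∈ U := by
        rw [hU, Module.End.mem_eigenspace_iff, Matrix.toLin'_apply]
        exact hv1
      rw [h0, Submodule.mem_bot] at hvU
      exact hv0 hvU
    rcases hirr.irred U hstab with h | h
    · exact absurd h hne
    · refine ⟨c, ?_⟩
      apply Matrix.toLin'.injective
      refine LinearMap.ext fun w => ?_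
      have hw : w ∈ U := by
        rw [h]
        exact Submodule.mem_top
      rw [hU, Module.End.mem_eigenspace_iff] at hw
      rw [hw, map_smul, Matrix.toLin'_one, LinearMap.smul_apply, LinearMap.id_apply]

include hKo hKc hρ in
/-- **Lemma D**: `trace B = μ(K) · [k = j]`. -/
theorem trace_schurMatrix (j k : Fin d) :
    Matrix.trace (schurMatrix S K ρ j k) = (((S.μ (K : Set G)).toReal : ℝ) : ℂ) * (if k = j then 1 else 0) := by
  haveI := S.haar
  have hm : MeasurableSet (K : Set G) := hKo.measurableSet
  simp only [Matrix.trace, Matrix.diag, schurMatrix, Matrix.of_apply]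
  rw [← integral_finsetSum _ (fun i _ => integrableOn_coef_mul S K ρ hKo hKc hρ i j k i)]
  have : ∫ h in (K : Set G), ∑ i, repExt K ρ h i j * repExt K ρ h⁻¹ k i ∂S.μ
      = ∫ _ in (K : Set G), (if k = j then (1 : ℂ) else 0) ∂S.μ := by
    refine setIntegral_congr_fun hm fun h hh => ?_
    have h1 : ∑ i, repExt K ρ h i j * repExt K ρ h⁻¹ k i = (repExt K ρ h⁻¹ * repExt K ρ h) k j := by
      rw [Matrix.mul_apply]
      exact Finset.sum_congr rfl fun i _ => mul_comm _ _
    rw [h1, ← repExt_mul K ρ (K.inv_mem hh) hh, inv_mul_cancel, repExt_one, Matrix.one_apply]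
  rw [this, setIntegral_const, measureReal_def, Complex.real_smul]

include hKo hKc hρ in
/-- **Theorem E (SCHUR ORTHOGONALITY of the matrix coefficients of one irreducible unitary `ρ`, against `S.μ` on `K`)**:
`∫_K ρ(h)_{ij} ρ(h⁻¹)_{kl} dμ(h) = (μ(K)/d) · [i = l] · [k = j]`. -/
theorem schur_orthogonality (hirr : IsIrreducibleRep ρ) (i j k l : Fin d) :
    ∫ h in (K : Set G), repExt K ρ h i j * repExt K ρ h⁻¹ k l ∂S.μ
      = ((((S.μ (K : Set G)).toReal / d : ℝ)) : ℂ) * ((if i = l then 1 else 0) * (if k = j then 1 else 0)) := by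
  have hcomm : ∀ k₀ : K, ρ k₀ * schurMatrix S K ρ j k = schurMatrix S K ρ j k * ρ k₀ := by
    intro k₀
    have := schurMatrix_comm S K ρ hKo hKc hρ j k k₀.2
    rwa [repExt_coe] at this
  obtain ⟨c, hc⟩ := eq_smul_one_of_comm K ρ hirr _ hcomm
  have htr := trace_schurMatrix S K ρ hKo hKc hρ j k
  rw [hc, Matrix.trace_smul, Matrix.trace_one, Fintype.card_fin, smul_eq_mul] at htr
  have hd : (d : ℂ) ≠ 0 := by exact_mod_cast (Fin.pos i).ne'
  have hcval : c = ((((S.μ (K : Set G)).toReal : ℝ) : ℂ) * (if k = j then 1 else 0)) / d := by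
    rw [eq_div_iff hd]
    exact htr
  have hB : ∫ h in (K : Set G), repExt K ρ h i j * repExt K ρ h⁻¹ k l ∂S.μ = schurMatrix S K ρ j k i l := rfl
  rw [hB, hc, Matrix.smul_apply, Matrix.one_apply, smul_eq_mul, hcval, Complex.ofReal_div, Complex.ofReal_natCast]
  ring

omit [IsTopologicalGroup G] [BorelSpace G] in
/-- a triple finite sum of integrable functions: integral and sums commute. -/
theorem setIntegral_triple_sum {F : Fin d → Fin d → Fin d → G → ℂ}
    (hF : ∀ i k l, Integrable (F i k l) (S.μ.restrict (K : Set G))) :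
    ∫ h in (K : Set G), ∑ i, ∑ k, ∑ l, F i k l h ∂S.μ = ∑ i, ∑ k, ∑ l, ∫ h in (K : Set G), F i k l h ∂S.μ := by
  rw [integral_finsetSum _ (fun i _ => integrable_finsetSum _ (fun k _ => integrable_finsetSum _ (fun l _ => hF i k l)))]
  refine Finset.sum_congr rfl fun i _ => ?_
  rw [integral_finsetSum _ (fun k _ => integrable_finsetSum _ (fun l _ => hF i k l))]
  refine Finset.sum_congr rfl fun k _ => ?_
  rw [integral_finsetSum _ (fun l _ => hF i k l)]

include hKo hKc hρ in
/-- **Lemma F (character convolution)**: for `g ∈ K`, `∫_K χ_σ(h) χ_σ(h⁻¹ g) dμ(h) = (μ(K)/d) · χ_σ(g)`. -/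
theorem charExt_conv (hirr : IsIrreducibleRep ρ) {g : G} (hg : g ∈ K) :
    ∫ h in (K : Set G), charExt K ρ h * charExt K ρ (h⁻¹ * g) ∂S.μ
      = ((((S.μ (K : Set G)).toReal / d : ℝ)) : ℂ) * charExt K ρ g := by
  haveI := S.haar
  have hm : MeasurableSet (K : Set G) := hKo.measurableSet
  have hexp : ∀ h ∈ (K : Set G), charExt K ρ h * charExt K ρ (h⁻¹ * g)
      = ∑ i, ∑ k, ∑ l, repExt K ρ h i i * (repExt K ρ h⁻¹ k l * repExt K ρ g l k) := by
    intro h hh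
    unfold charExt
    rw [repExt_mul K ρ (K.inv_mem hh) hg]
    simp only [Matrix.trace, Matrix.diag, Matrix.mul_apply]
    simp only [Finset.sum_mul_sum]
    simp only [Finset.mul_sum]
  have hint : ∀ i k l, Integrable (fun h => repExt K ρ h i i * (repExt K ρ h⁻¹ k l * repExt K ρ g l k))
      (S.μ.restrict (K : Set G)) := fun i k l => by
    simpa only [mul_assoc] using (integrableOn_coef_mul S K ρ hKo hKc hρ i i k l).mul_const (repExt K ρ g l k)
  rw [setIntegral_congr_fun hm hexp, setIntegral_triple_sum S K hint]
  simp only [← mul_assoc, integral_mul_const, schur_orthogonality S K ρ hKo hKc hρ hirr]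
  simp [Finset.sum_ite_eq, Finset.sum_ite_eq', Finset.mul_sum, charExt, Matrix.trace, Matrix.diag]

end Schur

section Idempotent

variable (hKo : IsOpen (K : Set G)) (hKc : IsCompact (K : Set G)) (hρ : Continuous ρ)

include hKo hKc hρ in
/-- **Theorem G — `eσ` IS IDEMPOTENT for the setting's convolution**: `eσ ⋆ eσ = eσ` (Schur orthogonality, `conv_eσ_eσ`). -/
theorem conv_eσ_eσ (hirr : IsIrreducibleRep ρ) : S.conv (eσ S K ρ) (eσ S K ρ) = eσ S K ρ := by
  haveI := S.haar
  have hm : MeasurableSet (K : Set G) := hKo.measurableSet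
  funext g
  unfold conv
  have hind : (fun h => eσ S K ρ h * eσ S K ρ (h⁻¹ * g))
      = (K : Set G).indicator fun h => eσ S K ρ h * eσ S K ρ (h⁻¹ * g) := by
    funext h
    by_cases hh : h ∈ K
    · rw [Set.indicator_of_mem (show h ∈ (K : Set G) from hh)]
    · rw [Set.indicator_of_notMem (show h ∉ (K : Set G) from hh), eσ_of_not_mem S K ρ hh, zero_mul]
  rw [hind, integral_indicator hm]
  by_cases hg : g ∈ K
  · rcases Nat.eq_zero_or_pos d with hd | hd
    · have h0 : eσ S K ρ = fun _ => 0 := by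
        funext x
        simp only [eσ, hd, Nat.cast_zero, zero_mul]
      simp only [h0, mul_zero, integral_zero]
    · set c : ℂ := (d : ℂ) * ((((S.μ (K : Set G)).toReal)⁻¹ : ℝ) : ℂ) with hc
      have h1 : ∫ h in (K : Set G), eσ S K ρ h * eσ S K ρ (h⁻¹ * g) ∂S.μ
          = ∫ h in (K : Set G), (c * c) * starRingEnd ℂ (charExt K ρ h * charExt K ρ (h⁻¹ * g)) ∂S.μ := by
        refine setIntegral_congr_fun hm fun h _ => ?_
        simp only [eσ, map_mul, hc]
        ring
      rw [h1, integral_const_mul, integral_conj, charExt_conv S K ρ hKo hKc hρ hirr hg, map_mul,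
        Complex.conj_ofReal]
      have hμ : (S.μ (K : Set G)).toReal ≠ 0 := measure_toReal_ne_zero S K hKo hKc
      have hdr : (d : ℝ) ≠ 0 := by exact_mod_cast hd.ne'
      have hone : c * ((((S.μ (K : Set G)).toReal / d : ℝ)) : ℂ) = 1 := by
        rw [hc, Complex.ofReal_div, Complex.ofReal_natCast, Complex.ofReal_inv]
        have hμc : ((S.μ (K : Set G)).toReal : ℂ) ≠ 0 := by exact_mod_cast hμ
        have hdc : (d : ℂ) ≠ 0 := by exact_mod_cast hd.ne'
        field_simp
      calc c * c * (((((S.μ (K : Set G)).toReal / d : ℝ)) : ℂ) * starRingEnd ℂ (charExt K ρ g))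
          = c * (c * ((((S.μ (K : Set G)).toReal / d : ℝ)) : ℂ)) * starRingEnd ℂ (charExt K ρ g) := by ring
        _ = c * starRingEnd ℂ (charExt K ρ g) := by rw [hone, mul_one]
        _ = eσ S K ρ g := rfl
  · have h0 : ∫ h in (K : Set G), eσ S K ρ h * eσ S K ρ (h⁻¹ * g) ∂S.μ = ∫ _ in (K : Set G), (0 : ℂ) ∂S.μ := by
      refine setIntegral_congr_fun hm fun h hh => ?_
      have : h⁻¹ * g ∉ K := fun hc => hg (by simpa using K.mul_mem hh hc)
      rw [eσ_of_not_mem S K ρ this, mul_zero]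
    rw [h0, integral_zero, eσ_of_not_mem S K ρ hg]

end Idempotent




end RTF.Setting

end Summit.Ventures.HodgeRepro.Tier4.Line1
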